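import Mathlib.NumberTheory.NumberField.Basic
import Mathlib.NumberTheory.NumberField.Discriminant.Basic
import Mathlib.NumberTheory.NumberField.InfinitePlace.Basic
import Mathlib.RingTheory.Discriminant
import Mathlib.FieldTheory.Minpoly.IsIntegrallyClosed
import Mathlib.Algebra.Polynomial.SpecificDegree
import Mathlib.Algebra.Polynomial.Eval.Irreducible
import Mathlib.FieldTheory.Galois.Basic
import Mathlib.RingTheory.Norm.Transitivity
import Mathlib.NumberTheory.NumberField.Norm
import Literature.NumberTheory.NumberFields.IntegralBasisCriterion
import Literature.NumberTheory.LFunctions.DegreeOnePrimes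
import HarnessLib

/-!
# The cyclic quintic field of conductor `11`: `K = ℚ(ζ₁₁)⁺ = ℚ(θ)`, `θ⁵ + θ⁴ - 4θ³ - 3θ² + 3θ + 1 = 0`

The maximal real subfield of `ℚ(ζ₁₁)` — the smallest of the six quintic subfields of the
degree-`25` field `F₅ ⊂ ℚ(ζ₁₁, ζ₂₄₁)` of T. Dokchitser–V. Dokchitser, *A note on the Mordell–Weil
rank modulo `n`*, J. Number Theory 131 (2011), proof of Thm. 2 (the fields over which "2-descent
shows that `rk E/F₅ = 1` […] e.g. using Magma, over all minimal non-trivial subfields"; tree files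
`Literature/Barriers/BirchSwinnertonDyer/RankNotSumOfLocalInvariantsF5*.lean`) — made explicit as
`K = ℚ[X]/(f)`, `f = X⁵ + X⁴ - 4X³ - 3X² + 3X + 1`, the minimal polynomial of `θ = ζ + ζ⁻¹ =
2cos(2π/11)`. This is the degree-`5` analogue of the tree's `CyclicCubicField13.lean`, whose layout
it follows. Everything is PROVED:

* `quinticPoly`, `K`, `θ`: `f` is irreducible (it is irreducible modulo `2`: no root and no
  quadratic factor over `𝔽₂`, by the finite criterion `irreducible_quintic_of_forall`),
  `K = AdjoinRoot f` is a number field of degree `5` (`finrank_K`), `minpoly θ = f`, `N(θ) = -1`.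
* **`Gal(K/ℚ) = ⟨σ⟩ ≅ C₅`**: `σ θ = θ² - 2` (`ζ ↦ ζ²` on `θ = ζ + ζ⁻¹`; `f(X² - 2) = f(X)·g(X)`),
  the conjugates `σ²θ = θ⁴ - 4θ² + 2`, `σ³θ = θ³ - 3θ`, `σ⁴θ = -θ⁴ - θ³ + 3θ² + 2θ - 1`, `σ⁵ = 1`,
  `|Gal(K/ℚ)| = 5`, `IsGalois ℚ K`, every automorphism is a power of `σ` (`gal_eq_pow`), and
  `N(x) = ∏_{i<5} σⁱ x` (`norm_eq_prod_pow_σ`).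
* **`|disc(1, θ, …, θ⁴)| = 14641 = 11⁴`** without a `5 × 5` determinant: in `K`,
  `f'(θ) = ε (θ - 2)⁴` and `11 = ε' (θ - 2)⁵` with explicit units `ε, ε'` of `ℤ[θ]`, so
  `|N(θ - 2)|⁵ = 11⁵`, `|N(f'(θ))| = 11⁴` (`abs_discr_pbθ`).
* **`𝓞 K = ℤ[θ]`** (`isIntegralClosure_adjoin_θ`, `mem_adjoin_θ`, `adjoin_θint_eq_top`): from
  `14641 = [𝓞_K : ℤ[θ]]² |d_K|` (the tree's `discr_powerBasis_eq_indexDet_sq_mul_discr`) and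
  Minkowski's `|d_K| ≥ 5¹⁰/((4/π)⁴ · 120²) > 121` (`NumberField.abs_discr_ge'`, `r₂ ≤ 2`), so the
  index is `1`; `|d_K| = 14641` (`abs_discr_eq`).
* The unit `θ` (`θ · (θ⁴ + θ³ - 4θ² - 3θ + 3) = -1`) and the presentation lemma `θint_rel`.

What is NOT here (sibling files `CyclicQuinticField11Units.lean`, `…Primes.lean`, `…Descent.lean`):
the five real embeddings and the units `σⁱθ` modulo squares; the primes `2, 3, 5` (inert) and class
number one; the `2`-descent of `480a1` over `K`.

## References

* T. Dokchitser, V. Dokchitser, J. Number Theory 131 (2011) 1833–1839, proof of Thm. 2.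
  [DokchitserDokchitser2011RankModN]
* D. A. Marcus, *Number Fields*, 2nd ed. (2018), Ch. 2, Exercise 27 (discriminant criterion for a
  power integral basis) and Exercise 35 (`ℤ[ζ_p + ζ_p⁻¹]`). [cite: Marcus2018, Ch. 2, Exercise 27(d)]
* L. C. Washington, *Introduction to Cyclotomic Fields*, GTM 83, Prop. 2.16 (`𝓞_{ℚ(ζ)⁺} = ℤ[ζ + ζ⁻¹]`).
  [folklore]

## Design notes

`K` is `AdjoinRoot` of the `ℚ`-polynomial, `θ = AdjoinRoot.root`; identities in `θ` are closed by
`linear_combination q(θ) * θ_rel` with the quotient `q = (lhs - rhs)/f` computed externally (exact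
polynomial division) and checked here by `ring`. Grouping namespace
`Literature.NumberTheory.NumberFields.CyclicQuintic11` (named after the object).
-/

noncomputable section

open Polynomial NumberField Algebra

namespace Literature.NumberTheory.NumberFields

/-! ### A finite irreducibility criterion for monic quintics over a field -/

/-- **Irreducibility of a monic quintic by trial division.** Over a field, a monic quintic
`X⁵ + a₄X⁴ + a₃X³ + a₂X² + a₁X + a₀` with no root and no factorisation
`(X² + bX + c)(X³ + dX² + eX + g)` (five coefficient identities) is irreducible: a non-trivial
monic factor of degree `≤ 5/2` has degree `1` or `2` (`Polynomial.Monic.irreducible_iff_lt_natDegree_lt`).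
Over `ZMod p` both hypotheses are decidable. [folklore] -/
theorem irreducible_quintic_of_forall {F : Type*} [Field F] (a0 a1 a2 a3 a4 : F)
    (hroot : ∀ x : F, x ^ 5 + a4 * x ^ 4 + a3 * x ^ 3 + a2 * x ^ 2 + a1 * x + a0 ≠ 0)
    (hquad : ∀ b c d e g : F, ¬ (d + b = a4 ∧ e + b * d + c = a3 ∧ g + b * e + c * d = a2 ∧
      b * g + c * e = a1 ∧ c * g = a0)) :
    Irreducible (X ^ 5 + C a4 * X ^ 4 + C a3 * X ^ 3 + C a2 * X ^ 2 + C a1 * X + C a0 : F[X]) := by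
  set p : F[X] := X ^ 5 + C a4 * X ^ 4 + C a3 * X ^ 3 + C a2 * X ^ 2 + C a1 * X + C a0 with hp
  have hmonic : p.Monic := by rw [hp]; monicity!
  have hdeg : p.natDegree = 5 := by rw [hp]; compute_degree!
  have hp1 : p ≠ 1 := fun h => by
    have := congrArg natDegree h
    rw [hdeg, natDegree_one] at this
    exact absurd this (by norm_num)
  refine (hmonic.irreducible_iff_lt_natDegree_lt hp1).mpr fun q hq hqdeg hqdvd => ?_
  rw [hdeg, Finset.mem_Ioc] at hqdeg
  have hq12 : q.natDegree = 1 ∨ q.natDegree = 2 := by omega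
  rcases hq12 with h1 | h2
  · -- a linear factor gives a root
    have hqe : q = X + C (q.coeff 0) := hq.eq_X_add_C h1
    have hroot' : p.eval (-q.coeff 0) = 0 := by
      refine eval_eq_zero_of_dvd_of_eval_eq_zero hqdvd ?_
      rw [hqe]; simp
    apply hroot (-q.coeff 0)
    rw [hp] at hroot'
    simpa using hroot'
  · -- a quadratic factor: compare coefficients of `p = q r`
    obtain ⟨r, hpr⟩ := hqdvd
    have hr : r.Monic := Monic.of_mul_monic_left hq (hpr ▸ hmonic)
    have hrdeg : r.natDegree = 3 := by
      have := hq.natDegree_mul hr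
      rw [← hpr, hdeg, h2] at this
      omega
    set b := q.coeff 1; set c := q.coeff 0
    set d := r.coeff 2; set e := r.coeff 1; set g := r.coeff 0
    have hqe : q = X ^ 2 + C b * X + C c := by
      conv_lhs => rw [hq.as_sum, h2]
      simp [Finset.sum_range_succ]
      ring
    have hre : r = X ^ 3 + C d * X ^ 2 + C e * X + C g := by
      conv_lhs => rw [hr.as_sum, hrdeg]
      simp [Finset.sum_range_succ]
      ring
    have hE : (C (a4 - (d + b)) * X ^ 4 + C (a3 - (e + b * d + c)) * X ^ 3 +
        C (a2 - (g + b * e + c * d)) * X ^ 2 + C (a1 - (b * g + c * e)) * X + C (a0 - c * g) : F[X])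
          = p - q * r := by
      rw [hp, hqe, hre]
      simp only [map_sub, map_add, map_mul]
      ring
    rw [← hpr, sub_self] at hE
    have hc := fun n => congrArg (coeff · n) hE
    have h4 := hc 4; have h3 := hc 3; have h2' := hc 2; have h1' := hc 1; have h0 := hc 0
    simp only [coeff_add, coeff_C_mul, coeff_X_pow, coeff_X, coeff_C, coeff_zero] at h4 h3 h2' h1' h0
    norm_num at h4 h3 h2' h1' h0
    exact hquad b c d e g ⟨(sub_eq_zero.mp h4).symm, (sub_eq_zero.mp h3).symm,
      (sub_eq_zero.mp h2').symm, (sub_eq_zero.mp h1').symm, (sub_eq_zero.mp h0).symm⟩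

namespace CyclicQuintic11

/-! ### The polynomial `f = X⁵ + X⁴ - 4X³ - 3X² + 3X + 1` -/

/-- `f = X⁵ + X⁴ - 4X³ - 3X² + 3X + 1 ∈ ℤ[X]`, the minimal polynomial of `2cos(2π/11) = ζ₁₁ + ζ₁₁⁻¹`
(the defining polynomial of the maximal real subfield of `ℚ(ζ₁₁)`). [folklore] -/
abbrev quinticPoly : ℤ[X] := X ^ 5 + X ^ 4 - C 4 * X ^ 3 - C 3 * X ^ 2 + C 3 * X + C 1

/-- `f ∈ ℚ[X]` (base change of `quinticPoly`). [folklore] -/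
abbrev quinticPolyRat : ℚ[X] := quinticPoly.map (algebraMap ℤ ℚ)

/-- `quinticPolyRat = X⁵ + X⁴ - 4X³ - 3X² + 3X + 1` (numeral coefficients: the `simp` normal form
of the base change). [folklore] -/
theorem quinticPolyRat_eq :
    quinticPolyRat = X ^ 5 + X ^ 4 - 4 * X ^ 3 - 3 * X ^ 2 + 3 * X + 1 := by
  simp only [quinticPolyRat, quinticPoly, Polynomial.map_add, Polynomial.map_sub,
    Polynomial.map_mul, Polynomial.map_pow, map_X, eq_intCast, Int.cast_ofNat, Int.cast_one]
  norm_num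

/-- `f` is monic. [folklore] -/
theorem quinticPoly_monic : quinticPoly.Monic := by
  unfold quinticPoly
  monicity!

/-- `deg f = 5`. [folklore] -/
theorem quinticPoly_natDegree : quinticPoly.natDegree = 5 := by
  unfold quinticPoly
  compute_degree!

/-- `f mod 2 = X⁵ + X⁴ + X² + X + 1` as a polynomial over `𝔽₂`. [folklore] -/
theorem quinticPoly_map_two :
    quinticPoly.map (Int.castRingHom (ZMod 2)) =
      X ^ 5 + C (1 : ZMod 2) * X ^ 4 + C 0 * X ^ 3 + C 1 * X ^ 2 + C 1 * X + C 1 := by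
  ext n
  simp only [quinticPoly, Polynomial.coeff_map, Int.coe_castRingHom, coeff_add, coeff_sub,
    coeff_C_mul, coeff_X_pow, coeff_X, coeff_C, Int.cast_add, Int.cast_sub, Int.cast_mul,
    Int.cast_ite, Int.cast_one, Int.cast_zero, Int.cast_ofNat]
  rcases n with _ | _ | _ | _ | _ | _ | n
  iterate 6 · norm_num <;> decide
  · simp

/-- **`f` is irreducible modulo `2`**: `X⁵ + X⁴ + X² + X + 1` has no root in `𝔽₂` and no quadratic
factor over `𝔽₂` (`X² + X + 1 ∤ f`), by the finite criterion `irreducible_quintic_of_forall`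
(both checks by `decide`). Equivalently: `2` is inert in `K` (`ord₁₁(2) = 10`). [folklore] -/
theorem irreducible_map_zmod_two : Irreducible (quinticPoly.map (Int.castRingHom (ZMod 2))) := by
  rw [quinticPoly_map_two]
  exact irreducible_quintic_of_forall (F := ZMod 2) 1 1 1 0 1 (by decide) (by decide)

/-- `f` is irreducible over `ℤ` (it is irreducible modulo `2`). [folklore] -/
theorem quinticPoly_irreducible : Irreducible quinticPoly :=
  Monic.irreducible_of_irreducible_map (Int.castRingHom (ZMod 2)) _ quinticPoly_monic
    irreducible_map_zmod_two

/-- `f` is irreducible over `ℚ` (Gauss). [folklore] -/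
theorem quinticPolyRat_irreducible : Irreducible quinticPolyRat :=
  quinticPoly_monic.irreducible_iff_irreducible_map_fraction_map.mp quinticPoly_irreducible

/-- Irreducibility of `f` over `ℚ` as a `Fact`, so that `AdjoinRoot quinticPolyRat` is a field.
[folklore] -/
instance : Fact (Irreducible quinticPolyRat) := ⟨quinticPolyRat_irreducible⟩

/-- `f ≠ 0` in `ℚ[X]`. [folklore] -/
theorem quinticPolyRat_ne_zero : quinticPolyRat ≠ 0 := quinticPolyRat_irreducible.ne_zero

/-- `quinticPolyRat` is monic. [folklore] -/
theorem quinticPolyRat_monic : quinticPolyRat.Monic := quinticPoly_monic.map _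

/-- `deg quinticPolyRat = 5`. [folklore] -/
theorem quinticPolyRat_natDegree : quinticPolyRat.natDegree = 5 := by
  show (quinticPoly.map (algebraMap ℤ ℚ)).natDegree = 5
  rw [quinticPoly_monic.natDegree_map, quinticPoly_natDegree]

/-- `deg quinticPolyRat = 5` as a `degree`. [folklore] -/
theorem quinticPolyRat_degree : quinticPolyRat.degree = 5 := by
  rw [degree_eq_natDegree quinticPolyRat_ne_zero, quinticPolyRat_natDegree]; rfl

/-! ### The field `K = ℚ[X]/(f)` and its generator `θ` -/

/-- **The cyclic quintic field of conductor `11`**, `K = ℚ[X]/(X⁵ + X⁴ - 4X³ - 3X² + 3X + 1)`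
(`≅ ℚ(ζ₁₁)⁺`). [folklore] -/
abbrev K : Type := AdjoinRoot quinticPolyRat

/-- `K` is a number field. [folklore] -/
instance : NumberField K := by unfold K; infer_instance

/-- `θ ∈ K`, the class of `X` (`= 2cos(2π/11)` under the real embedding `θ ↦ 1.68…`). [folklore] -/
def θ : K := AdjoinRoot.root quinticPolyRat

/-- **The defining relation** `θ⁵ + θ⁴ - 4θ³ - 3θ² + 3θ + 1 = 0`. [folklore] -/
theorem θ_rel : θ ^ 5 + θ ^ 4 - 4 * θ ^ 3 - 3 * θ ^ 2 + 3 * θ + 1 = 0 := by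
  have h : eval₂ (AdjoinRoot.of quinticPolyRat) (AdjoinRoot.root quinticPolyRat) quinticPolyRat = 0 :=
    AdjoinRoot.eval₂_root quinticPolyRat
  rw [eval₂_map, quinticPoly] at h
  simp only [eval₂_add, eval₂_sub, eval₂_mul, eval₂_X_pow, eval₂_X, eval₂_ofNat, eval₂_one,
    map_ofNat, map_one] at h
  exact h

/-- `θ⁵ = -θ⁴ + 4θ³ + 3θ² - 3θ - 1`. [folklore] -/
theorem θ_pow_five : θ ^ 5 = -θ ^ 4 + 4 * θ ^ 3 + 3 * θ ^ 2 - 3 * θ - 1 := by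
  linear_combination θ_rel

/-- `θ` is a root of `f ∈ ℤ[X]`. [folklore] -/
theorem aeval_θ_quinticPoly : aeval θ quinticPoly = 0 := by
  rw [quinticPoly]
  simp only [map_add, map_sub, map_pow, map_mul, aeval_X, map_ofNat, map_one]
  linear_combination θ_rel

/-- `θ` is a root of `f ∈ ℚ[X]`. [folklore] -/
theorem aeval_θ : aeval θ quinticPolyRat = 0 :=
  (aeval_map_algebraMap ℚ θ quinticPoly).trans aeval_θ_quinticPoly

/-- `θ` is an algebraic integer. [folklore] -/
theorem isIntegral_θ : IsIntegral ℤ θ := ⟨quinticPoly, quinticPoly_monic, aeval_θ_quinticPoly⟩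

/-- `minpoly_ℤ θ = f`. [folklore] -/
theorem minpoly_int_θ : minpoly ℤ θ = quinticPoly :=
  (eq_of_monic_of_associated (minpoly.monic isIntegral_θ) quinticPoly_monic
    ((minpoly.irreducible isIntegral_θ).associated_of_dvd quinticPoly_irreducible
      (minpoly.isIntegrallyClosed_dvd isIntegral_θ aeval_θ_quinticPoly)))

/-- `minpoly_ℚ θ = f`. [folklore] -/
theorem minpoly_rat_θ :
    minpoly ℚ θ = X ^ 5 + X ^ 4 - 4 * X ^ 3 - 3 * X ^ 2 + 3 * X + 1 := by
  rw [minpoly.isIntegrallyClosed_eq_field_fractions' ℚ isIntegral_θ, minpoly_int_θ]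
  exact quinticPolyRat_eq

/-- The power basis `1, θ, …, θ⁴` of `K/ℚ`. [folklore] -/
def pbθ : PowerBasis ℚ K := AdjoinRoot.powerBasis quinticPolyRat_ne_zero

/-- The generator of `pbθ` is `θ`. [folklore] -/
theorem pbθ_gen : pbθ.gen = θ := AdjoinRoot.powerBasis_gen _

/-- `pbθ` has dimension `5`. [folklore] -/
theorem pbθ_dim : pbθ.dim = 5 := by
  rw [pbθ, AdjoinRoot.powerBasis_dim, quinticPolyRat_natDegree]

/-- **`[K : ℚ] = 5`.** [folklore] -/
theorem finrank_K : Module.finrank ℚ K = 5 := by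
  rw [← pbθ_dim, PowerBasis.finrank]

/-- `N_{K/ℚ}(θ) = -1` (`= (-1)⁵ f(0)`). [folklore] -/
theorem norm_θ : Algebra.norm ℚ θ = -1 := by
  have h := PowerBasis.norm_gen_eq_coeff_zero_minpoly pbθ
  rw [pbθ_gen, pbθ_dim, minpoly_rat_θ] at h
  rw [h]
  norm_num [coeff_X_pow, coeff_X, coeff_one]

/-- `θ` is a unit of `ℤ[θ]`: `θ · (θ⁴ + θ³ - 4θ² - 3θ + 3) = -1`. [folklore] -/
theorem θ_mul_eq_neg_one : θ * (θ ^ 4 + θ ^ 3 - 4 * θ ^ 2 - 3 * θ + 3) = -1 := by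
  linear_combination θ_rel

/-- The class of a quartic `aX⁴ + bX³ + cX² + dX + e` is `aθ⁴ + bθ³ + cθ² + dθ + e`. [folklore] -/
theorem mk_quartic (a b c d e : ℚ) :
    AdjoinRoot.mk quinticPolyRat (C a * X ^ 4 + C b * X ^ 3 + C c * X ^ 2 + C d * X + C e) =
      (a : K) * θ ^ 4 + (b : K) * θ ^ 3 + (c : K) * θ ^ 2 + (d : K) * θ + e := by
  simp only [map_add, map_mul, map_pow, AdjoinRoot.mk_C, AdjoinRoot.mk_X, eq_ratCast]
  rfl

/-- **A non-zero polynomial of degree `≤ 4` does not vanish at `θ`** (`f`, of degree `5`, is the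
minimal polynomial). [folklore] -/
theorem quartic_ne_zero {a b c d e : ℚ} (h : (a, b, c, d, e) ≠ (0, 0, 0, 0, 0)) :
    (a : K) * θ ^ 4 + (b : K) * θ ^ 3 + (c : K) * θ ^ 2 + (d : K) * θ + e ≠ 0 := by
  rw [← mk_quartic, Ne, AdjoinRoot.mk_eq_zero]
  intro hdvd
  have hq0 : (C a * X ^ 4 + C b * X ^ 3 + C c * X ^ 2 + C d * X + C e : ℚ[X]) ≠ 0 := by
    intro h0
    apply h
    have ha : a = 0 := by simpa using congrArg (coeff · 4) h0
    have hb : b = 0 := by simpa [ha] using congrArg (coeff · 3) h0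
    have hc : c = 0 := by simpa [ha, hb] using congrArg (coeff · 2) h0
    have hd : d = 0 := by simpa [ha, hb, hc] using congrArg (coeff · 1) h0
    have he : e = 0 := by simpa [ha, hb, hc, hd] using congrArg (coeff · 0) h0
    rw [ha, hb, hc, hd, he]
  have hdeg := degree_le_of_dvd hdvd hq0
  rw [quinticPolyRat_degree] at hdeg
  have h4 : (C a * X ^ 4 + C b * X ^ 3 + C c * X ^ 2 + C d * X + C e : ℚ[X]).degree ≤ 4 := by
    refine (degree_le_iff_coeff_zero _ _).mpr fun n hn => ?_
    have hn' : 4 < n := by exact_mod_cast hn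
    simp only [coeff_add, coeff_C_mul, coeff_X_pow, coeff_X, coeff_C]
    rcases n with _ | _ | _ | _ | _ | n <;> simp_all
  exact absurd (hdeg.trans h4) (by decide)

/-! ### The automorphism `σ : θ ↦ θ² - 2` of order `5`; `K/ℚ` is Galois -/

/-- `θ² - 2` is again a root of `f`: `f(X² - 2) = f(X) · (X⁵ - X⁴ - 4X³ + 3X² + 3X - 1)`. (With
`θ = ζ + ζ⁻¹` this is `ζ² + ζ⁻²`, the image of `θ` under `ζ ↦ ζ²`.) [folklore] -/
theorem aeval_σθ : aeval (θ ^ 2 - 2) quinticPolyRat = 0 := by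
  refine (aeval_map_algebraMap ℚ _ quinticPoly).trans ?_
  rw [quinticPoly]
  simp only [map_add, map_sub, map_pow, map_mul, aeval_X, map_ofNat, map_one]
  linear_combination (θ ^ 5 - θ ^ 4 - 4 * θ ^ 3 + 3 * θ ^ 2 + 3 * θ - 1) * θ_rel

/-- The `ℚ`-algebra endomorphism of `K` sending `θ ↦ θ² - 2`. [folklore] -/
def σHom : K →ₐ[ℚ] K :=
  AdjoinRoot.liftAlgHom quinticPolyRat (Algebra.ofId ℚ K) (θ ^ 2 - 2) aeval_σθ

/-- `σHom θ = θ² - 2`. [folklore] -/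
theorem σHom_θ : σHom θ = θ ^ 2 - 2 := AdjoinRoot.liftAlgHom_root _ _ _ _

/-- **The automorphism `σ` of `K/ℚ`**, `σ(θ) = θ² - 2` (`σHom` is bijective: an injective
endomorphism of a finite-dimensional space). [folklore] -/
def σ : K ≃ₐ[ℚ] K :=
  AlgEquiv.ofBijective σHom ⟨(σHom : K →+* K).injective,
    LinearMap.surjective_of_injective (f := σHom.toLinearMap) (σHom : K →+* K).injective⟩

/-- `σ θ = θ² - 2`. [folklore] -/
theorem σ_θ : σ θ = θ ^ 2 - 2 := σHom_θ

/-- `σ²θ = θ⁴ - 4θ² + 2` (`= ζ⁴ + ζ⁻⁴`). [folklore] -/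
theorem σ_σ_θ : σ (σ θ) = θ ^ 4 - 4 * θ ^ 2 + 2 := by
  rw [σ_θ, map_sub, map_pow, σ_θ, map_ofNat]
  ring

/-- `σ³θ = θ³ - 3θ` (`= ζ⁸ + ζ⁻⁸ = ζ³ + ζ⁻³`). [folklore] -/
theorem σ_pow_three_θ : σ (σ (σ θ)) = θ ^ 3 - 3 * θ := by
  rw [σ_σ_θ]
  simp only [map_add, map_sub, map_pow, map_mul, σ_θ, map_ofNat]
  linear_combination (2 - 3 * θ - θ ^ 2 + θ ^ 3) * θ_rel

/-- `σ⁴θ = -θ⁴ - θ³ + 3θ² + 2θ - 1` (`= ζ⁵ + ζ⁻⁵`). [folklore] -/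
theorem σ_pow_four_θ : σ (σ (σ (σ θ))) = -θ ^ 4 - θ ^ 3 + 3 * θ ^ 2 + 2 * θ - 1 := by
  rw [σ_pow_three_θ]
  simp only [map_sub, map_pow, map_mul, σ_θ, map_ofNat]
  linear_combination (-1 + θ) * θ_rel

/-- `σ⁵θ = θ`. [folklore] -/
theorem σ_pow_five_θ : σ (σ (σ (σ (σ θ)))) = θ := by
  rw [σ_pow_four_θ]
  simp only [map_sub, map_add, map_neg, map_pow, map_mul, σ_θ, map_ofNat, map_one]
  linear_combination (-1 + 2 * θ + θ ^ 2 - θ ^ 3) * θ_rel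

/-- A `ℚ`-algebra automorphism of `K = ℚ(θ)` is determined by the image of `θ`. [folklore] -/
theorem algEquiv_eq_of_apply_θ {g h : K ≃ₐ[ℚ] K} (hgh : g θ = h θ) : g = h := by
  apply AlgEquiv.coe_toAlgHom_injective
  refine AdjoinRoot.algHom_ext ?_
  change g θ = h θ
  exact hgh

/-- `σ ^ n` applied to `θ`, as an iterate. [folklore] -/
theorem σ_pow_apply (n : ℕ) (x : K) : (σ ^ n) x = σ^[n] x := by
  induction n with
  | zero => rfl
  | succ n ih => rw [pow_succ', AlgEquiv.mul_apply, ih, Function.iterate_succ_apply']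

/-- **`σ⁵ = 1`** in `Gal(K/ℚ)`. [folklore] -/
theorem σ_pow_five : σ ^ 5 = 1 :=
  algEquiv_eq_of_apply_θ (by rw [σ_pow_apply]; exact σ_pow_five_θ)

/-- `σᵏ ≠ 1` for `0 < k < 5` (`σᵏθ - θ` is a non-zero polynomial of degree `≤ 4` in `θ`).
[folklore] -/
theorem σ_pow_ne_one {k : ℕ} (hk0 : 0 < k) (hk5 : k < 5) : σ ^ k ≠ 1 := by
  intro h
  have e : (σ ^ k) θ = θ := by rw [h]; rfl
  rw [σ_pow_apply] at e
  interval_cases k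
  · change σ θ = θ at e
    rw [σ_θ] at e
    refine quartic_ne_zero (a := 0) (b := 0) (c := 1) (d := -1) (e := -2) (by norm_num) ?_
    push_cast; linear_combination e
  · change σ (σ θ) = θ at e
    rw [σ_σ_θ] at e
    refine quartic_ne_zero (a := 1) (b := 0) (c := -4) (d := -1) (e := 2) (by norm_num) ?_
    push_cast; linear_combination e
  · change σ (σ (σ θ)) = θ at e
    rw [σ_pow_three_θ] at e
    refine quartic_ne_zero (a := 0) (b := 1) (c := 0) (d := -4) (e := 0) (by norm_num) ?_
    push_cast; linear_combination e
  · change σ (σ (σ (σ θ))) = θ at e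
    rw [σ_pow_four_θ] at e
    refine quartic_ne_zero (a := -1) (b := -1) (c := 3) (d := 1) (e := -1) (by norm_num) ?_
    push_cast; linear_combination e

/-- The powers `σ⁰, …, σ⁴` are pairwise distinct. [folklore] -/
theorem σ_pow_injective : Function.Injective fun i : Fin 5 => σ ^ (i : ℕ) := by
  intro i j hij
  simp only at hij
  rcases le_total (i : ℕ) j with h | h
  · have hji : σ ^ ((j : ℕ) - i) = 1 := by
      rw [← mul_left_inj (σ ^ (i : ℕ)), ← pow_add, Nat.sub_add_cancel h, one_mul]; exact hij.symm
    by_contra hne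
    exact σ_pow_ne_one (k := (j : ℕ) - i) (by omega) (by omega) hji
  · have hji : σ ^ ((i : ℕ) - j) = 1 := by
      rw [← mul_left_inj (σ ^ (j : ℕ)), ← pow_add, Nat.sub_add_cancel h, one_mul]; exact hij
    by_contra hne
    exact σ_pow_ne_one (k := (i : ℕ) - j) (by omega) (by omega) hji

/-- **`|Gal(K/ℚ)| = 5`**: `σ⁰, …, σ⁴` are distinct and `|Aut_ℚ(K)| ≤ [K : ℚ] = 5`. [folklore] -/
theorem card_gal : Nat.card (K ≃ₐ[ℚ] K) = 5 := by
  classical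
  rw [Nat.card_eq_fintype_card]
  refine le_antisymm (finrank_K ▸ AlgEquiv.card_le) ?_
  simpa using Fintype.card_le_of_injective _ σ_pow_injective

/-- **`K/ℚ` is Galois** (cyclic of degree `5`). [folklore] -/
instance isGalois : IsGalois ℚ K :=
  IsGalois.of_card_aut_eq_finrank ℚ K (card_gal.trans finrank_K.symm)

/-- `i ↦ σⁱ` is a bijection `Fin 5 ≃ Gal(K/ℚ)`. [folklore] -/
theorem σ_pow_bijective : Function.Bijective fun i : Fin 5 => σ ^ (i : ℕ) := by
  classical
  refine (Fintype.bijective_iff_injective_and_card _).mpr ⟨σ_pow_injective, ?_⟩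
  rw [Fintype.card_fin, ← Nat.card_eq_fintype_card, card_gal]

/-- **`Gal(K/ℚ) = ⟨σ⟩`**: every automorphism is `σⁱ` for some `i < 5`. [folklore] -/
theorem gal_eq_pow (g : K ≃ₐ[ℚ] K) : ∃ i : Fin 5, g = σ ^ (i : ℕ) := by
  obtain ⟨i, hi⟩ := σ_pow_bijective.2 g
  exact ⟨i, hi.symm⟩

/-- **`N_{K/ℚ}(x) = ∏_{i<5} σⁱ(x)`** for every `x ∈ K`. [folklore] -/
theorem norm_eq_prod_pow_σ (x : K) :
    algebraMap ℚ K (Algebra.norm ℚ x) = ∏ i : Fin 5, (σ ^ (i : ℕ)) x := by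
  classical
  rw [Algebra.norm_eq_prod_automorphisms]
  exact (Fintype.prod_bijective _ σ_pow_bijective _ _ fun _ => rfl).symm

/-- The norm as an explicit product `x · σx · σ²x · σ³x · σ⁴x`. [folklore] -/
theorem norm_eq_prod_σ (x : K) :
    algebraMap ℚ K (Algebra.norm ℚ x) = x * σ x * σ (σ x) * σ (σ (σ x)) * σ (σ (σ (σ x))) := by
  rw [norm_eq_prod_pow_σ, Fin.prod_univ_five]
  simp only [Fin.val_zero, Fin.val_one, Fin.val_two, pow_zero, pow_one, AlgEquiv.one_apply,
    σ_pow_apply, Function.iterate_succ_apply', Function.iterate_zero_apply,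
    show ((3 : Fin 5) : ℕ) = 3 from rfl, show ((4 : Fin 5) : ℕ) = 4 from rfl]

/-! ### `|disc(1, θ, …, θ⁴)| = 11⁴` via the units `ε, ε'` with `f'(θ) = ε(θ-2)⁴`, `11 = ε'(θ-2)⁵` -/

/-- `θ` as an element of `𝓞 K`. [folklore] -/
def θint : 𝓞 K := ⟨θ, isIntegral_θ⟩

/-- The coercion of `θint` to `K` is `θ`. [folklore] -/
@[simp] theorem coe_θint : ((θint : 𝓞 K) : K) = θ := rfl

/-- The quintic relation in `𝓞 K`: `θ⁵ + θ⁴ - 4θ³ - 3θ² + 3θ + 1 = 0`. [folklore] -/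
theorem θint_rel : (θint : 𝓞 K) ^ 5 + θint ^ 4 - 4 * θint ^ 3 - 3 * θint ^ 2 + 3 * θint + 1 = 0 := by
  apply RingOfIntegers.coe_injective
  simp only [map_add, map_sub, map_mul, map_pow, map_one, map_zero, coe_θint, map_ofNat]
  exact θ_rel

/-- The unit `ε = -59 - 213θ + 49θ² + 265θ³ + 99θ⁴` of `ℤ[θ]` (so that `f'(θ) = ε (θ - 2)⁴`), with
inverse `14 + 12θ - 41θ² - 3θ³ + 12θ⁴`. [folklore] -/
def unitε : (𝓞 K)ˣ :=
  Units.mkOfMulEqOne (-59 - 213 * θint + 49 * θint ^ 2 + 265 * θint ^ 3 + 99 * θint ^ 4)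
    (14 + 12 * θint - 41 * θint ^ 2 - 3 * θint ^ 3 + 12 * θint ^ 4)
    (by linear_combination (-827 - 1209 * θint + 1695 * θint ^ 2 + 1188 * θint ^ 3) * θint_rel)

/-- The unit `ε' = 111 + 399θ - 99θ² - 505θ³ - 188θ⁴` of `ℤ[θ]` (so that `11 = ε' (θ - 2)⁵`:
`11` is totally ramified, `(11) = (θ - 2)⁵`), with inverse `-3 + 7θ - 7θ² + 4θ³ - θ⁴`. [folklore] -/
def unitε' : (𝓞 K)ˣ :=
  Units.mkOfMulEqOne (111 + 399 * θint - 99 * θint ^ 2 - 505 * θint ^ 3 - 188 * θint ^ 4)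
    (-3 + 7 * θint - 7 * θint ^ 2 + 4 * θint ^ 3 - θint ^ 4)
    (by linear_combination (-334 + 582 * θint - 435 * θint ^ 2 + 188 * θint ^ 3) * θint_rel)

/-- The norm of a unit of `𝓞 K` is `±1`. [folklore] -/
theorem abs_norm_unit (u : (𝓞 K)ˣ) : |Algebra.norm ℚ ((u : 𝓞 K) : K)| = 1 := by
  rw [← Algebra.coe_norm_int, ← Int.cast_abs, show (1 : ℚ) = ((1 : ℤ) : ℚ) by norm_num,
    Int.cast_inj]
  exact Int.isUnit_iff_abs_eq.mp (u.isUnit.map (Algebra.norm ℤ))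

/-- `f' = 5X⁴ + 4X³ - 12X² - 6X + 3`. [folklore] -/
theorem derivative_minpoly :
    derivative (minpoly ℚ θ) = C 5 * X ^ 4 + C 4 * X ^ 3 - C 12 * X ^ 2 - C 6 * X + C 3 := by
  rw [minpoly_rat_θ]
  ext n
  simp only [coeff_derivative, coeff_add, coeff_sub, coeff_ofNat_mul, coeff_C_mul, coeff_X_pow,
    coeff_X, coeff_C, coeff_one]
  rcases n with _ | _ | _ | _ | _ | n
  iterate 5 · norm_num
  · simp

/-- **`f'(θ) = ε (θ - 2)⁴`**: the different is the fourth power of the prime above `11`.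
[folklore] -/
theorem aeval_derivative_minpoly :
    aeval θ (derivative (minpoly ℚ θ)) = ((unitε : (𝓞 K)ˣ) : 𝓞 K) * (θ - 2) ^ 4 := by
  rw [derivative_minpoly, unitε, Units.val_mkOfMulEqOne]
  simp only [map_add, map_sub, map_mul, map_pow, aeval_X, map_neg, map_ofNat, coe_θint]
  linear_combination (947 - 1327 * θ + 626 * θ ^ 2 - 99 * θ ^ 3) * θ_rel

/-- **`11 = ε' (θ - 2)⁵`** in `K`. [folklore] -/
theorem eleven_eq : (11 : K) = ((unitε' : (𝓞 K)ˣ) : 𝓞 K) * (θ - 2) ^ 5 := by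
  rw [unitε', Units.val_mkOfMulEqOne]
  simp only [map_add, map_sub, map_mul, map_pow, map_ofNat, coe_θint]
  linear_combination (3563 - 6801 * θ + 4884 * θ ^ 2 - 1563 * θ ^ 3 + 188 * θ ^ 4) * θ_rel

/-- **`|N(θ - 2)| = 11`**: from `11⁵ = N(11) = ±N(θ - 2)⁵` (`11` is the norm of the totally
ramified prime `(θ - 2)`). [folklore] -/
theorem abs_norm_θ_sub_two : |Algebra.norm ℚ (θ - 2 : K)| = 11 := by
  have h := congrArg (Algebra.norm ℚ) eleven_eq
  rw [map_mul, map_pow, show (11 : K) = algebraMap ℚ K 11 from (map_ofNat _ 11).symm,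
    Algebra.norm_algebraMap, finrank_K] at h
  have habs : (11 : ℚ) ^ 5 = |Algebra.norm ℚ (θ - 2 : K)| ^ 5 := by
    have h' := congrArg abs h
    rwa [abs_mul, abs_pow, abs_pow, abs_norm_unit, one_mul, abs_of_pos (by norm_num : (0 : ℚ) < 11)]
      at h'
  exact ((pow_left_inj₀ (by norm_num) (abs_nonneg _) (by norm_num : (5 : ℕ) ≠ 0)).mp habs).symm

/-- **`|N(f'(θ))| = 14641 = 11⁴`.** [folklore] -/
theorem abs_norm_aeval_derivative : |Algebra.norm ℚ (aeval θ (derivative (minpoly ℚ θ)))| = 14641 := by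
  rw [aeval_derivative_minpoly, map_mul, map_pow, abs_mul, abs_pow, abs_norm_unit,
    abs_norm_θ_sub_two]
  norm_num

/-- **`|disc(1, θ, …, θ⁴)| = 14641 = 11⁴`** (the discriminant of `f`; `(-1)^{5·4/2} = 1`).
[folklore] -/
theorem abs_discr_pbθ : |Algebra.discr ℚ pbθ.basis| = 14641 := by
  rw [Algebra.discr_powerBasis_eq_norm, finrank_K, pbθ_gen, abs_mul, abs_norm_aeval_derivative]
  norm_num

/-! ### `𝓞 K = ℤ[θ]`, `|d_K| = 14641` -/

/-- `θ` (as the generator of `pbθ`) is integral. [folklore] -/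
theorem isIntegral_pbθ_gen : IsIntegral ℤ pbθ.gen := by rw [pbθ_gen]; exact isIntegral_θ

/-- **Minkowski: `|d_K| > 121`.** For a quintic field `|d_K| ≥ 5¹⁰/((4/π)^{2r₂} (5!)²)` with
`r₂ ≤ 2`, and `5¹⁰ > 121 · (4/π)⁴ · 120²` since `π > 3`. [folklore] -/
theorem abs_discr_gt : (121 : ℤ) < |NumberField.discr K| := by
  have h := NumberField.abs_discr_ge' K
  rw [finrank_K] at h
  have hc : InfinitePlace.nrComplexPlaces K ≤ 2 := by
    have := InfinitePlace.card_add_two_mul_card_eq_rank K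
    rw [finrank_K] at this
    omega
  have hpi3 : (3 : ℝ) < Real.pi := Real.pi_gt_three
  have hpi4 : Real.pi ≤ 4 := Real.pi_le_four
  have h1 : (1 : ℝ) ≤ 4 / Real.pi := by rw [le_div_iff₀ Real.pi_pos]; linarith
  have hpow : (4 / Real.pi) ^ (2 * InfinitePlace.nrComplexPlaces K) ≤ (4 / Real.pi) ^ 4 :=
    pow_le_pow_right₀ h1 (by omega)
  have h43 : (4 / Real.pi) ^ 4 < (4 / 3 : ℝ) ^ 4 :=
    pow_lt_pow_left₀ (div_lt_div_of_pos_left (by norm_num) (by norm_num) hpi3) (by positivity)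
      (by norm_num)
  have h43' := h43.le
  have hfac : ((Nat.factorial 5 : ℕ) : ℝ) = 120 := by norm_num [Nat.factorial]
  rw [hfac] at h
  have hpos : (0 : ℝ) < (4 / Real.pi) ^ (2 * InfinitePlace.nrComplexPlaces K) * 120 ^ 2 := by positivity
  have key : ((5 : ℕ) : ℝ) ^ (2 * 5) ≤ |(NumberField.discr K : ℝ)| * ((4 / Real.pi) ^ 4 * 120 ^ 2) := by
    have h' := (div_le_iff₀ hpos).mp h
    push_cast at h' ⊢
    refine h'.trans ?_
    gcongr
  have hlt : ¬ (|(NumberField.discr K : ℝ)| ≤ 121) := by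
    intro hle
    have : |(NumberField.discr K : ℝ)| * ((4 / Real.pi) ^ 4 * 120 ^ 2) ≤ 121 * ((4 / 3 : ℝ) ^ 4 * 120 ^ 2) := by
      gcongr
    have h5 : ((5 : ℕ) : ℝ) ^ (2 * 5) = 9765625 := by norm_num
    linarith
  have : (121 : ℝ) < |(NumberField.discr K : ℝ)| := lt_of_not_ge hlt
  exact_mod_cast this

/-- The index determinant of `1, θ, …, θ⁴` in an integral basis is a unit, i.e. **`1, θ, …, θ⁴` is
an integral basis**: `14641 = [𝓞_K : ℤ[θ]]² · |d_K|` with `|d_K| > 121` forces the index to be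
`1` (the square divisors of `11⁴` being `1, 11², 11⁴`). [folklore] -/
theorem isUnit_indexDet : IsUnit (indexDet pbθ isIntegral_pbθ_gen) := by
  set r := indexDet pbθ isIntegral_pbθ_gen with hr
  have key := discr_powerBasis_eq_indexDet_sq_mul_discr pbθ isIntegral_pbθ_gen
  have habs : (14641 : ℤ) = r ^ 2 * |NumberField.discr K| := by
    have h := abs_discr_pbθ
    rw [key, abs_mul, abs_pow, sq_abs, ← Int.cast_abs] at h
    exact_mod_cast h.symm
  have hgt := abs_discr_gt
  have hr0 : r ≠ 0 := indexDet_ne_zero pbθ isIntegral_pbθ_gen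
  -- `r² ∣ 11⁴`, so `|r| ∣ 121`; `|r| ≥ 11` would give `|d_K| ≤ 121`.
  have hdvd : r.natAbs ^ 2 ∣ 121 ^ 2 := by
    have : (r ^ 2).natAbs ∣ (14641 : ℤ).natAbs := Int.natAbs_dvd_natAbs.mpr ⟨_, habs⟩
    simpa [Int.natAbs_pow] using this
  have hr121 : r.natAbs ∣ 121 := (Nat.pow_dvd_pow_iff two_ne_zero).mp hdvd
  have hcases : r.natAbs = 1 ∨ 11 ≤ r.natAbs := by
    have hmem : r.natAbs ∈ Nat.divisors 121 := Nat.mem_divisors.mpr ⟨hr121, by norm_num⟩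
    have : Nat.divisors 121 = {1, 11, 121} := by decide
    rw [this] at hmem
    simp only [Finset.mem_insert, Finset.mem_singleton] at hmem
    omega
  rcases hcases with h1 | h11
  · exact Int.isUnit_iff_natAbs_eq.mpr h1
  · exfalso
    have hsq : (121 : ℤ) ≤ r ^ 2 := by
      have : (11 : ℤ) ≤ |r| := by rw [Int.abs_eq_natAbs]; exact_mod_cast h11
      nlinarith [sq_abs r, abs_nonneg r]
    nlinarith [abs_nonneg (NumberField.discr K)]

/-- **`|d_K| = 14641 = 11⁴`.** [folklore] -/
theorem abs_discr_eq : |NumberField.discr K| = 14641 := by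
  have key := discr_powerBasis_eq_indexDet_sq_mul_discr pbθ isIntegral_pbθ_gen
  have h1 : ((indexDet pbθ isIntegral_pbθ_gen : ℤ) : ℚ) ^ 2 = 1 := by
    rcases Int.isUnit_iff.mp isUnit_indexDet with h' | h' <;> simp [h']
  rw [h1, one_mul] at key
  have h := congrArg abs key
  rw [abs_discr_pbθ, ← Int.cast_abs] at h
  exact_mod_cast h.symm

/-- **`𝓞 K = ℤ[θ]`**: `ℤ[θ]` is the integral closure of `ℤ` in `K`. [folklore] -/
theorem isIntegralClosure_adjoin_θ : IsIntegralClosure (Algebra.adjoin ℤ ({θ} : Set K)) ℤ K := by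
  have h := isIntegralClosure_adjoin_of_isUnit_indexDet pbθ isIntegral_pbθ_gen isUnit_indexDet
  rwa [pbθ_gen] at h

/-- Every algebraic integer of `K` lies in `ℤ[θ]`. [folklore] -/
theorem mem_adjoin_θ (x : 𝓞 K) : (x : K) ∈ Algebra.adjoin ℤ ({θ} : Set K) := by
  have h := mem_adjoin_of_isUnit_indexDet pbθ isIntegral_pbθ_gen isUnit_indexDet x
  rwa [pbθ_gen] at h

/-- `ℤ[θ] = 𝓞 K`, as subalgebras of `𝓞 K`. [folklore] -/
theorem adjoin_θint_eq_top : Algebra.adjoin ℤ ({θint} : Set (𝓞 K)) = ⊤ := by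
  refine Algebra.eq_top_iff.2 fun b => ?_
  apply Literature.NumberTheory.LFunctions.DegreeOnePrimes.mem_adjoin_of_coe_mem_adjoin
  rw [coe_θint]
  exact mem_adjoin_θ b

/-- The Dedekind–Kummer exponent of `θ` is `1` (trivial conductor), so Dedekind's factorisation
theorem applies at every prime. [folklore] -/
theorem exponent_θint : RingOfIntegers.exponent θint = 1 :=
  RingOfIntegers.exponent_eq_one_iff.mpr adjoin_θint_eq_top

/-- `minpoly_ℤ θint = f`. [folklore] -/
theorem minpoly_θint : minpoly ℤ θint = quinticPoly := by
  rw [← RingOfIntegers.minpoly_coe, coe_θint]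
  convert minpoly_int_θ
  exact Subsingleton.elim _ _

/-- **The unit `θ`** of `𝓞 K` (`N(θ) = -1`), with inverse `-(θ⁴ + θ³ - 4θ² - 3θ + 3)`. [folklore] -/
def unitθ : (𝓞 K)ˣ :=
  Units.mkOfMulEqOne θint (-(θint ^ 4 + θint ^ 3 - 4 * θint ^ 2 - 3 * θint + 3))
    (by linear_combination (-1 : 𝓞 K) * θint_rel)

/-- The underlying element of `unitθ` is `θ`. [folklore] -/
@[simp] theorem coe_unitθ : ((unitθ : (𝓞 K)ˣ) : 𝓞 K) = θint := rfl

end CyclicQuintic11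

end Literature.NumberTheory.NumberFields

end
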